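import Mathlib
import HarnessLib
import Summits.ValiantsHypothesis.ValiantsHypothesis.Theorems.MonotoneRestorationMonotoneRestorationQPLinearWidthCFIOddCoverChains
import Summits.ValiantsHypothesis.ValiantsHypothesis.Theorems.MonotoneRestorationMonotoneRestorationQPLinearWidthWallChains
import Summits.ValiantsHypothesis.ValiantsHypothesis.Theorems.MonotoneRestorationMonotoneRestorationQPLinearWidthWallConnected

/-!
# Route MonotoneRestoration, crux `MonotoneRestorationQP` (stmt-15886), line `linear_width` —
# THE PARITY-ADAPTIVE BASE: long wall-edge paths in a pattern ⇒ a chain system (CH₂) with `C = 14`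

Helper file (`--supports stmt-ValiantsHypothesis-15886`), def-free; item (P) of the g15 residue list.  Input: injective
branch vertices `fv` of `W_r` in `patternGraph E` and, for every wall edge `e` (chosen ends `(p,q)`), an injective path
`i ↦ gv e i`, `0 ≤ i ≤ ωL e`, from `fv p` to `fv q`, `ωL e ≥ 6`, interiors off the branch vertices (I2) and pairwise disjoint
(I3) — the output of `WallChains`.  Base: `B = psubdiv W_r ℓ 1` on `Fin N` with `ℓ e = 1` iff `ωL e` is even (connected,
`W_r ≼ₘ B` so `tw B ≥ k` for `2k+1 ≤ r`, max degree `≤ 3` so `|CFI(B)| ≤ 14N`, `N ≤ a+b`).  Chains: a dart of `B` is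
(edge `e`, segment `[lo,hi] ∈ {[0,ωL e]} ∪ {[0,3],[3,ωL e]}`, direction) and its chain reads `gv e` along the segment; all
segments are odd `≥ 3`, reversal flips the direction, (I2)/(I3)/injectivity give the disjointness conditions of
`CFIOddCover.oddCover_of_chains`.  Result: **`chainSystem_of_wallPaths`**.  Honest label: plumbing; no stub closed; θ₁, the
cruxes and VP ≠ VNP NOT moved. [cite: Diestel2010, §1.7; GalesiEtAl2023, §2; Roberson2022, Thm 3.13]
-/

set_option linter.dupNamespace false

noncomputable section
open scoped Classical
open scoped Literature.Combinatorics.SimpleGraph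

namespace Summit.ValiantsHypothesis.ValiantsHypothesis.Theorems.CFIOddCover
open Literature.Combinatorics.SimpleGraph
open Literature.ModelTheory.FiniteModelTheory Literature.ModelTheory.FiniteModelTheory.ChenFlumLiu2025
open Summit.ValiantsHypothesis.ValiantsHypothesis.Theorems.MonotoneRestorationQPLinearWidth

/-- **(P) THE PARITY-ADAPTIVE BASE AND ITS CHAIN SYSTEM.**  From long wall-edge paths in the pattern graph of `E` (data
`fv, gv, ωL` with (I2), (I3)) and `2k+1 ≤ r`: a connected base `B` on `Fin N` (`N ≥ 2`) with `tw B ≥ k`, an edge,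
`|CFI(B)| ≤ 14(a+b+1)`, and a chain system over `B` in the sense of `CFIOddCover.oddCover_of_chains`.
[cite: Diestel2010, §1.7; Roberson2022, Thm 3.13] -/
theorem chainSystem_of_wallPaths {a b r k : ℕ} (E : Multiset (Fin a × Fin b)) (hk : 2 * k + 1 ≤ r)
    (fv : Fin (r + 1) × Fin (r + 1) → Fin a ⊕ Fin b) (hfv : Function.Injective fv)
    (gv : Sym2 (Fin (r + 1) × Fin (r + 1)) → ℕ → Fin a ⊕ Fin b) (ωL : Sym2 (Fin (r + 1) × Fin (r + 1)) → ℕ)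
    (h6 : ∀ e ∈ (wall r).edgeSet, 6 ≤ ωL e)
    (h0 : ∀ e ∈ (wall r).edgeSet, gv e 0 = fv (edgeOut e).1)
    (hL : ∀ e ∈ (wall r).edgeSet, gv e (ωL e) = fv (edgeOut e).2)
    (hadjg : ∀ e ∈ (wall r).edgeSet, ∀ i, i < ωL e → (patternGraph E).Adj (gv e i) (gv e (i + 1)))
    (hinj : ∀ e ∈ (wall r).edgeSet, ∀ i j, i ≤ ωL e → j ≤ ωL e → gv e i = gv e j → i = j)
    (hI2 : ∀ e ∈ (wall r).edgeSet, ∀ i, 0 < i → i < ωL e → ∀ z, gv e i ≠ fv z)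
    (hI3 : ∀ e ∈ (wall r).edgeSet, ∀ e' ∈ (wall r).edgeSet, ∀ i i', e ≠ e' → 0 < i → i < ωL e → 0 < i' →
      i' < ωL e' → gv e i ≠ gv e' i') :
    ∃ (v : ℕ) (B : SimpleGraph (Fin v)), B.Connected ∧ 2 ≤ v ∧
      k ≤ treewidth B ∧ B.edgeSet.Nonempty ∧ Fintype.card (CFIVertex B) ≤ 14 * (a + b + 1) ∧
      ∃ (β : Fin v → Fin a ⊕ Fin b) (n : Dart B → ℕ) (c : Dart B → ℕ → Fin a ⊕ Fin b),
        Function.Injective β ∧ (∀ d, n d.rev = n d) ∧ (∀ d, c d 0 = β d.1.1) ∧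
        (∀ d i, i ≤ 2 * n d + 3 → c d.rev i = c d (2 * n d + 3 - i)) ∧
        (∀ d i, i < 2 * n d + 3 → (patternGraph E).Adj (c d i) (c d (i + 1))) ∧
        (∀ d i, 0 < i → i < 2 * n d + 3 → ∀ u, c d i ≠ β u) ∧
        (∀ d d' i i', 0 < i → i < 2 * n d + 3 → 0 < i' → i' < 2 * n d' + 3 → c d i = c d' i' →
          d' = d ∨ d' = d.rev) := by
  classical
  let ℓ : Sym2 (Fin (r + 1) × Fin (r + 1)) → ℕ := fun e => if Even (ωL e) then 1 else 0
  have hℓ1 : ∀ e, ℓ e ≤ 1 := fun e => by simp only [ℓ]; split_ifs <;> omega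
  have hℓeven : ∀ e, ℓ e = 1 ↔ Even (ωL e) := fun e => by simp only [ℓ]; split_ifs <;> simp [*]
  have hℓodd : ∀ e, ℓ e = 0 ↔ ¬ Even (ωL e) := fun e => by simp only [ℓ]; split_ifs <;> simp [*]
  have hℓin : ∀ y : {q : Sym2 (Fin (r + 1) × Fin (r + 1)) × Fin 1 // q.1 ∈ (wall r).edgeSet ∧ (q.2 : ℕ) < ℓ q.1},
      Even (ωL y.1.1) := fun y => (hℓeven _).1 (by have := y.2.2; have := hℓ1 y.1.1; omega)
  set B₀ := psubdiv (wall r) ℓ 1 with hB₀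
  have hconn₀ : B₀.Connected := psubdiv_connected (wall_connected r) fun e _ => hℓ1 e
  have hcardV : Fintype.card (Fin (r + 1) × Fin (r + 1)) ≤ Fintype.card (PSubdivVertex (wall r) ℓ 1) :=
    Fintype.card_le_of_injective Sum.inl Sum.inl_injective
  have h2 : 2 ≤ Fintype.card (PSubdivVertex (wall r) ℓ 1) := by
    refine le_trans ?_ hcardV
    rw [Fintype.card_prod, Fintype.card_fin]; nlinarith
  have htw₀ : k ≤ treewidth B₀ :=
    (CFIHomMonotone.le_treewidth_wall hk).trans
      (CFIHomMonotone.treewidth_le_of_isMinor (isMinor_psubdiv fun e _ => hℓ1 e))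
  set N := Fintype.card (PSubdivVertex (wall r) ℓ 1) with hN
  have φ : PSubdivVertex (wall r) ℓ 1 ≃ Fin N := Fintype.equivFin _
  set B := B₀.map φ.toEmbedding with hB
  letI instB : DecidableRel B.Adj := fun a b => Classical.propDecidable _
  have hconnB : B.Connected := (SimpleGraph.Iso.map φ B₀).connected_iff.1 hconn₀
  have htwB : k ≤ treewidth B :=
    htw₀.trans (treewidth_le_of_hom_injective (SimpleGraph.Iso.map φ B₀).toEmbedding.toHom
      (SimpleGraph.Iso.map φ B₀).injective)
  have hEB : B.edgeSet.Nonempty := by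
    obtain ⟨x, y, hxy⟩ : ∃ x y : Fin N, x ≠ y := ⟨⟨0, by omega⟩, ⟨1, by omega⟩, by simp [Fin.ext_iff]⟩
    obtain ⟨p⟩ := hconnB.preconnected x y
    have hlen : 0 < p.length :=
      Nat.pos_of_ne_zero fun h => hxy (SimpleGraph.Walk.eq_of_length_eq_zero h)
    exact ⟨s(p.getVert 0, p.getVert 1), (SimpleGraph.mem_edgeSet _).2 (p.adj_getVert_succ hlen)⟩
  have hBadj : ∀ u v : Fin N, B.Adj u v ↔ B₀.Adj (φ.symm u) (φ.symm v) := by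
    intro u v
    rw [hB, SimpleGraph.map_adj]
    constructor
    · rintro ⟨u', v', h, rfl, rfl⟩
      simpa using h
    · intro h
      exact ⟨φ.symm u, φ.symm v, h, by simp, by simp⟩
  have hdeg : ∀ v : Fin N, B.degree v ≤ 3 := by
    intro v
    obtain ⟨l, hl, hmem⟩ := psubdiv_neighbors_le_three (G := wall r) (ℓ := ℓ) (M := 1)
      (wall_neighbors_le_three r) (φ.symm v)
    rw [← SimpleGraph.card_neighborFinset_eq_degree]
    calc (B.neighborFinset v).card ≤ (l.map φ).toFinset.card := by
          refine Finset.card_le_card fun w hw => ?_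
          rw [SimpleGraph.mem_neighborFinset, hBadj] at hw
          rw [List.mem_toFinset, List.mem_map]
          exact ⟨φ.symm w, hmem _ hw, by simp⟩
      _ ≤ (l.map φ).length := List.toFinset_card_le _
      _ ≤ 3 := by simpa using hl
  have hmax : B.maxDegree ≤ 3 := B.maxDegree_le_of_forall_degree_le 3 hdeg
  let β₀ : PSubdivVertex (wall r) ℓ 1 → Fin a ⊕ Fin b := fun x =>
    match x with
    | .inl p => fv p
    | .inr y => gv y.1.1 3
  have hβ₀ : Function.Injective β₀ := by
    rintro (p | y) (p' | y') h
    · exact congrArg Sum.inl (hfv h)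
    · exact absurd h.symm (hI2 _ y'.2.1 3 (by norm_num) (by have := h6 _ y'.2.1; omega) p)
    · exact absurd h (hI2 _ y.2.1 3 (by norm_num) (by have := h6 _ y.2.1; omega) p')
    · change gv y.1.1 3 = gv y'.1.1 3 at h
      have he : y.1.1 = y'.1.1 := by
        by_contra hne
        exact hI3 _ y.2.1 _ y'.2.1 3 3 hne (by norm_num) (by have := h6 _ y.2.1; omega) (by norm_num)
          (by have := h6 _ y'.2.1; omega) h
      have hi : (y.1.2 : ℕ) = y'.1.2 := by have := y.1.2.is_lt; have := y'.1.2.is_lt; omega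
      rw [inner_ext he hi]
  have hNle : N ≤ a + b :=
    calc N = Fintype.card (PSubdivVertex (wall r) ℓ 1) := rfl
      _ ≤ Fintype.card (Fin a ⊕ Fin b) := Fintype.card_le_of_injective β₀ hβ₀
      _ = a + b := by rw [Fintype.card_sum, Fintype.card_fin, Fintype.card_fin]
  have hCFI : Fintype.card (CFIVertex B) ≤ 14 * (a + b + 1) := by
    calc Fintype.card (CFIVertex B) ≤ N * 2 ^ B.maxDegree + 2 * (N * B.maxDegree) := CFIHomMonotone.card_cfiVertex_le
      _ ≤ N * 2 ^ 3 + 2 * (N * 3) := by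
          gcongr
          · norm_num
      _ ≤ 14 * (a + b + 1) := by omega
  let eOf : PSubdivVertex (wall r) ℓ 1 → PSubdivVertex (wall r) ℓ 1 → Sym2 (Fin (r + 1) × Fin (r + 1)) := fun x y =>
    match x, y with
    | .inl p, .inl q => s(p, q)
    | .inl _, .inr yv => yv.1.1
    | .inr yv, _ => yv.1.1
  let dirOf : PSubdivVertex (wall r) ℓ 1 → PSubdivVertex (wall r) ℓ 1 → Bool := fun x y =>
    match x, y with
    | .inl p, .inl q => decide (p = (edgeOut s(p, q)).1)
    | .inl p, .inr yv => decide (p = (edgeOut yv.1.1).1)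
    | .inr yv, .inl p => !decide (p = (edgeOut yv.1.1).1)
    | .inr _, .inr _ => true
  let loOf : PSubdivVertex (wall r) ℓ 1 → PSubdivVertex (wall r) ℓ 1 → ℕ := fun x y =>
    match x, y with
    | .inl _, .inl _ => 0
    | .inl p, .inr yv => if p = (edgeOut yv.1.1).1 then 0 else 3
    | .inr yv, .inl p => if p = (edgeOut yv.1.1).1 then 0 else 3
    | .inr _, .inr _ => 0
  let hiOf : PSubdivVertex (wall r) ℓ 1 → PSubdivVertex (wall r) ℓ 1 → ℕ := fun x y =>
    match x, y with
    | .inl p, .inl q => ωL s(p, q)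
    | .inl p, .inr yv => if p = (edgeOut yv.1.1).1 then 3 else ωL yv.1.1
    | .inr yv, .inl p => if p = (edgeOut yv.1.1).1 then 3 else ωL yv.1.1
    | .inr _, .inr _ => 0
  have hdesc : ∀ x y, B₀.Adj x y →
      eOf x y ∈ (wall r).edgeSet ∧
      ((loOf x y = 0 ∧ hiOf x y = ωL (eOf x y) ∧ ¬ Even (ωL (eOf x y))) ∨
        (loOf x y = 0 ∧ hiOf x y = 3 ∧ Even (ωL (eOf x y))) ∨
        (loOf x y = 3 ∧ hiOf x y = ωL (eOf x y) ∧ Even (ωL (eOf x y)))) ∧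
      eOf y x = eOf x y ∧ loOf y x = loOf x y ∧ hiOf y x = hiOf x y ∧ dirOf y x = !dirOf x y ∧
      β₀ x = gv (eOf x y) (bif dirOf x y then loOf x y else hiOf x y) ∧
      β₀ y = gv (eOf x y) (bif dirOf x y then hiOf x y else loOf x y) := by
    rintro (p | yv) (q | yv') hxy
    · -- two wall vertices: an odd (unsubdivided) edge
      rw [hB₀, psubdiv_adj_inl_inl] at hxy
      obtain ⟨hpq, hℓ0⟩ := hxy
      have he : s(p, q) ∈ (wall r).edgeSet := (SimpleGraph.mem_edgeSet _).2 hpq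
      have hodd : ¬ Even (ωL s(p, q)) := (hℓodd _).1 hℓ0
      have hne12 : (edgeOut s(p, q)).1 ≠ (edgeOut s(p, q)).2 := (adj_edgeOut he).ne
      have hp := (mem_iff_edgeOut (e := s(p, q))).1 (Sym2.mem_mk_left p q)
      have hq := (mem_iff_edgeOut (e := s(p, q))).1 (Sym2.mem_mk_right p q)
      have hiff : (q = (edgeOut s(p, q)).1) ↔ ¬ (p = (edgeOut s(p, q)).1) := by
        constructor
        · rintro h1 h2; exact hpq.ne (h2.trans h1.symm)
        · intro h2
          rcases hq with h | h
          · exact h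
          · rcases hp with h' | h'
            · exact absurd h' h2
            · exact absurd (h'.trans h.symm) hpq.ne
      refine ⟨he, Or.inl ⟨rfl, rfl, hodd⟩, Sym2.eq_swap, rfl, ?_, ?_, ?_, ?_⟩
      · show ωL s(q, p) = ωL s(p, q)
        rw [Sym2.eq_swap]
      · show decide (q = (edgeOut s(q, p)).1) = !decide (p = (edgeOut s(p, q)).1)
        rw [Sym2.eq_swap, ← decide_not]
        exact decide_eq_decide.2 hiff
      · show fv p = gv s(p, q) (bif decide (p = (edgeOut s(p, q)).1) then 0 else ωL s(p, q))
        by_cases h1 : p = (edgeOut s(p, q)).1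
        · rw [decide_eq_true h1, cond_true, h0 _ he, ← h1]
        · rw [decide_eq_false h1, cond_false, hL _ he]
          rcases hp with h | h
          · exact absurd h h1
          · rw [← h]
      · show fv q = gv s(p, q) (bif decide (p = (edgeOut s(p, q)).1) then ωL s(p, q) else 0)
        by_cases h1 : p = (edgeOut s(p, q)).1
        · rw [decide_eq_true h1, cond_true, hL _ he]
          rcases hq with h | h
          · exact absurd (h1.trans h.symm) hpq.ne
          · rw [← h]
        · rw [decide_eq_false h1, cond_false, h0 _ he, ← hiff.2 h1]
    · -- wall vertex to midpoint
      rw [hB₀, psubdiv_adj_inl_inr] at hxy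
      have he : yv'.1.1 ∈ (wall r).edgeSet := yv'.2.1
      have heven : Even (ωL yv'.1.1) := hℓin yv'
      have hne12 : (edgeOut yv'.1.1).1 ≠ (edgeOut yv'.1.1).2 := (adj_edgeOut he).ne
      by_cases h1 : p = (edgeOut yv'.1.1).1
      · refine ⟨he, Or.inr (Or.inl ⟨if_pos h1, if_pos h1, heven⟩), rfl, rfl, rfl, ?_, ?_, ?_⟩
        · show (!decide (p = (edgeOut yv'.1.1).1)) = !decide (p = (edgeOut yv'.1.1).1); rfl
        · show fv p = gv yv'.1.1 (bif decide (p = (edgeOut yv'.1.1).1) then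
            (if p = (edgeOut yv'.1.1).1 then 0 else 3) else (if p = (edgeOut yv'.1.1).1 then 3 else ωL yv'.1.1))
          rw [decide_eq_true h1, cond_true, if_pos h1, h0 _ he, ← h1]
        · show gv yv'.1.1 3 = gv yv'.1.1 (bif decide (p = (edgeOut yv'.1.1).1) then
            (if p = (edgeOut yv'.1.1).1 then 3 else ωL yv'.1.1) else (if p = (edgeOut yv'.1.1).1 then 0 else 3))
          rw [decide_eq_true h1, cond_true, if_pos h1]
      · have hp2 : p = (edgeOut yv'.1.1).2 := by
          rcases hxy with ⟨h, -⟩ | ⟨h, -⟩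
          · exact absurd h h1
          · exact h
        refine ⟨he, Or.inr (Or.inr ⟨if_neg h1, if_neg h1, heven⟩), rfl, rfl, rfl, ?_, ?_, ?_⟩
        · show (!decide (p = (edgeOut yv'.1.1).1)) = !decide (p = (edgeOut yv'.1.1).1); rfl
        · show fv p = gv yv'.1.1 (bif decide (p = (edgeOut yv'.1.1).1) then
            (if p = (edgeOut yv'.1.1).1 then 0 else 3) else (if p = (edgeOut yv'.1.1).1 then 3 else ωL yv'.1.1))
          rw [decide_eq_false h1, cond_false, if_neg h1, hL _ he, ← hp2]
        · show gv yv'.1.1 3 = gv yv'.1.1 (bif decide (p = (edgeOut yv'.1.1).1) then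
            (if p = (edgeOut yv'.1.1).1 then 3 else ωL yv'.1.1) else (if p = (edgeOut yv'.1.1).1 then 0 else 3))
          rw [decide_eq_false h1, cond_false, if_neg h1]
    · -- midpoint to wall vertex
      rw [hB₀, psubdiv_adj_inr_inl] at hxy
      have he : yv.1.1 ∈ (wall r).edgeSet := yv.2.1
      have heven : Even (ωL yv.1.1) := hℓin yv
      by_cases h1 : q = (edgeOut yv.1.1).1
      · refine ⟨he, Or.inr (Or.inl ⟨if_pos h1, if_pos h1, heven⟩), rfl, rfl, rfl, ?_, ?_, ?_⟩
        · show decide (q = (edgeOut yv.1.1).1) = !!decide (q = (edgeOut yv.1.1).1)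
          rw [Bool.not_not]
        · show gv yv.1.1 3 = gv yv.1.1 (bif !decide (q = (edgeOut yv.1.1).1) then
            (if q = (edgeOut yv.1.1).1 then 0 else 3) else (if q = (edgeOut yv.1.1).1 then 3 else ωL yv.1.1))
          rw [decide_eq_true h1, Bool.not_true, cond_false, if_pos h1]
        · show fv q = gv yv.1.1 (bif !decide (q = (edgeOut yv.1.1).1) then
            (if q = (edgeOut yv.1.1).1 then 3 else ωL yv.1.1) else (if q = (edgeOut yv.1.1).1 then 0 else 3))
          rw [decide_eq_true h1, Bool.not_true, cond_false, if_pos h1, h0 _ he, ← h1]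
      · have hq2 : q = (edgeOut yv.1.1).2 := by
          rcases hxy with ⟨h, -⟩ | ⟨h, -⟩
          · exact absurd h h1
          · exact h
        refine ⟨he, Or.inr (Or.inr ⟨if_neg h1, if_neg h1, heven⟩), rfl, rfl, rfl, ?_, ?_, ?_⟩
        · show decide (q = (edgeOut yv.1.1).1) = !!decide (q = (edgeOut yv.1.1).1)
          rw [Bool.not_not]
        · show gv yv.1.1 3 = gv yv.1.1 (bif !decide (q = (edgeOut yv.1.1).1) then
            (if q = (edgeOut yv.1.1).1 then 0 else 3) else (if q = (edgeOut yv.1.1).1 then 3 else ωL yv.1.1))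
          rw [decide_eq_false h1, Bool.not_false, cond_true, if_neg h1]
        · show fv q = gv yv.1.1 (bif !decide (q = (edgeOut yv.1.1).1) then
            (if q = (edgeOut yv.1.1).1 then 3 else ωL yv.1.1) else (if q = (edgeOut yv.1.1).1 then 0 else 3))
          rw [decide_eq_false h1, Bool.not_false, cond_true, if_neg h1, hL _ he, ← hq2]
    · -- two midpoints are never adjacent (positions live in `Fin 1`)
      rw [hB₀, psubdiv_adj_inr_inr] at hxy
      have := yv.1.2.is_lt; have := yv'.1.2.is_lt; omega
  let X : Dart B → PSubdivVertex (wall r) ℓ 1 := fun d => φ.symm d.1.1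
  let Y : Dart B → PSubdivVertex (wall r) ℓ 1 := fun d => φ.symm d.1.2
  have hXY : ∀ d : Dart B, B₀.Adj (X d) (Y d) := fun d => (hBadj _ _).1 d.2
  let eD : Dart B → Sym2 (Fin (r + 1) × Fin (r + 1)) := fun d => eOf (X d) (Y d)
  let loD : Dart B → ℕ := fun d => loOf (X d) (Y d)
  let hiD : Dart B → ℕ := fun d => hiOf (X d) (Y d)
  let dirD : Dart B → Bool := fun d => dirOf (X d) (Y d)
  let pos : Dart B → ℕ → ℕ := fun d i => bif dirD d then loD d + i else hiD d - i
  let c : Dart B → ℕ → Fin a ⊕ Fin b := fun d i => gv (eD d) (pos d i)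
  let n : Dart B → ℕ := fun d => (hiD d - loD d - 3) / 2
  let β : Fin N → Fin a ⊕ Fin b := fun u => β₀ (φ.symm u)
  have hD : ∀ d : Dart B, eD d ∈ (wall r).edgeSet ∧
      ((loD d = 0 ∧ hiD d = ωL (eD d) ∧ ¬ Even (ωL (eD d))) ∨ (loD d = 0 ∧ hiD d = 3 ∧ Even (ωL (eD d))) ∨
        (loD d = 3 ∧ hiD d = ωL (eD d) ∧ Even (ωL (eD d)))) ∧
      eD d.rev = eD d ∧ loD d.rev = loD d ∧ hiD d.rev = hiD d ∧ dirD d.rev = !dirD d ∧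
      β d.1.1 = gv (eD d) (bif dirD d then loD d else hiD d) ∧
      β d.1.2 = gv (eD d) (bif dirD d then hiD d else loD d) := fun d => hdesc (X d) (Y d) (hXY d)
  have hseg : ∀ d : Dart B, 2 * n d + 3 = hiD d - loD d ∧ loD d + 3 ≤ hiD d ∧ hiD d ≤ ωL (eD d) ∧
      6 ≤ ωL (eD d) := by
    intro d
    obtain ⟨he, htri, -⟩ := hD d
    have h6e := h6 _ he
    have hn : n d = (hiD d - loD d - 3) / 2 := rfl
    rcases htri with ⟨hlo, hhi, hpar⟩ | ⟨hlo, hhi, hpar⟩ | ⟨hlo, hhi, hpar⟩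
    · rw [Nat.not_even_iff_odd] at hpar
      obtain ⟨j, hj⟩ := hpar
      omega
    · omega
    · obtain ⟨j, hj⟩ := hpar
      omega
  have hposg : ∀ (d : Dart B) (i : ℕ), 0 < i → i < 2 * n d + 3 → loD d < pos d i ∧ pos d i < hiD d := by
    intro d i hi0 hi
    obtain ⟨hlen, -, -, -⟩ := hseg d
    show loD d < (bif dirD d then loD d + i else hiD d - i) ∧ (bif dirD d then loD d + i else hiD d - i) < hiD d
    cases dirD d
    · simp only [cond_false]; omega
    · simp only [cond_true]; omega
  refine ⟨N, B, hconnB, h2, htwB, hEB, hCFI, β, n, c, hβ₀.comp φ.symm.injective, fun d => ?_, fun d => ?_,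
    fun d i hi => ?_, fun d i hi => ?_, fun d i hi0 hi u => ?_, fun d d' i i' hi0 hi hi0' hi' heq => ?_⟩
  · -- `n` is reversal invariant
    obtain ⟨-, -, -, hlo, hhi, -⟩ := hD d
    show (hiD d.rev - loD d.rev - 3) / 2 = (hiD d - loD d - 3) / 2
    rw [hlo, hhi]
  · -- start of the chain
    obtain ⟨-, -, -, -, -, -, hb, -⟩ := hD d
    show gv (eD d) (bif dirD d then loD d + 0 else hiD d - 0) = β d.1.1
    rw [hb, Nat.add_zero, Nat.sub_zero]
  · -- reversal
    obtain ⟨-, -, hee, hlo, hhi, hdir, -⟩ := hD d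
    obtain ⟨hlen, h3, hle, -⟩ := hseg d
    show gv (eD d.rev) (bif dirD d.rev then loD d.rev + i else hiD d.rev - i) =
      gv (eD d) (bif dirD d then loD d + (2 * n d + 3 - i) else hiD d - (2 * n d + 3 - i))
    rw [hee, hlo, hhi, hdir, hlen]
    cases dirD d
    · simp only [Bool.not_false, cond_true, cond_false]
      congr 1; omega
    · simp only [Bool.not_true, cond_false, cond_true]
      congr 1; omega
  · -- consecutive vertices are adjacent
    obtain ⟨he, -⟩ := hD d
    obtain ⟨hlen, h3, hle, -⟩ := hseg d
    show (patternGraph E).Adj (gv (eD d) (bif dirD d then loD d + i else hiD d - i))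
      (gv (eD d) (bif dirD d then loD d + (i + 1) else hiD d - (i + 1)))
    cases dirD d
    · simp only [cond_false]
      have h := hadjg _ he (hiD d - (i + 1)) (by omega)
      rw [show hiD d - (i + 1) + 1 = hiD d - i by omega] at h
      exact h.symm
    · simp only [cond_true]
      rw [← add_assoc]
      exact hadjg _ he _ (by omega)
  · -- interior vertices are not branch vertices
    obtain ⟨he, htri, -⟩ := hD d
    obtain ⟨hlen, h3, hle, h6e⟩ := hseg d
    have hpos := hposg d i hi0 hi
    show gv (eD d) (pos d i) ≠ β₀ (φ.symm u)
    rcases hu : φ.symm u with p | yv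
    · exact hI2 _ he _ (by omega) (by omega) p
    · show gv (eD d) (pos d i) ≠ gv yv.1.1 3
      have he' : yv.1.1 ∈ (wall r).edgeSet := yv.2.1
      have heven : Even (ωL yv.1.1) := hℓin yv
      have h6' := h6 _ he'
      by_cases hee : eD d = yv.1.1
      · -- same edge: it is even, the segment misses position `3`
        rw [hee]
        intro hgv
        have h33 := hinj _ he' _ _ (by rw [← hee]; omega) (by omega) hgv
        rw [hee] at htri
        rcases htri with ⟨-, -, hpar⟩ | ⟨hlo, hhi, -⟩ | ⟨hlo, hhi, -⟩
        · exact hpar heven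
        · omega
        · omega
      · exact hI3 _ he _ he' _ 3 hee (by omega) (by omega) (by norm_num) (by omega)
  · -- interiors of different darts only meet for a dart and its reverse
    obtain ⟨he, htri, hee, hlo, hhi, hdir, hb1, hb2⟩ := hD d
    obtain ⟨hlen, h3, hle, h6e⟩ := hseg d
    obtain ⟨he', htri', hee', hlo', hhi', hdir', hb1', hb2'⟩ := hD d'
    obtain ⟨hlen', h3', hle', h6e'⟩ := hseg d'
    have hpos := hposg d i hi0 hi
    have hpos' := hposg d' i' hi0' hi'
    change gv (eD d) (pos d i) = gv (eD d') (pos d' i') at heq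
    have hedge : eD d' = eD d := by
      by_contra hne
      exact hI3 _ he _ he' _ _ (Ne.symm hne) (by omega) (by omega) (by omega) (by omega) heq
    rw [hedge] at heq htri' hle'
    have hpp : pos d i = pos d' i' := hinj _ he _ _ (by omega) (by omega) heq
    have hseg_eq : loD d' = loD d ∧ hiD d' = hiD d := by
      rcases htri with ⟨hl, hh, hp⟩ | ⟨hl, hh, hp⟩ | ⟨hl, hh, hp⟩ <;>
        rcases htri' with ⟨hl', hh', hp'⟩ | ⟨hl', hh', hp'⟩ | ⟨hl', hh', hp'⟩
      all_goals first
        | exact absurd hp' hp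
        | exact absurd hp hp'
        | (constructor <;> omega)
    have hβinj : Function.Injective β := hβ₀.comp φ.symm.injective
    have hdart : ∀ d₁ d₂ : Dart B, β d₁.1.1 = β d₂.1.1 → β d₁.1.2 = β d₂.1.2 → d₁ = d₂ := by
      intro d₁ d₂ h1 h2
      exact Subtype.ext (Prod.ext (hβinj h1) (hβinj h2))
    cases hdd : dirD d' <;> cases hd : dirD d
    · -- same direction: `d' = d`
      left
      refine hdart _ _ ?_ ?_ <;>
        simp only [hb1', hb2', hb1, hb2, hedge, hdd, hd, hseg_eq.1, hseg_eq.2]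
    · -- opposite directions: `d' = d.rev`
      right
      obtain ⟨-, -, -, -, -, -, hr1, hr2⟩ := hD d.rev
      refine hdart _ _ ?_ ?_ <;>
        simp only [hb1', hb2', hr1, hr2, hee, hdir, hlo, hhi, hedge, hdd, hd, hseg_eq.1, hseg_eq.2,
          Bool.not_true, cond_false]
    · right
      obtain ⟨-, -, -, -, -, -, hr1, hr2⟩ := hD d.rev
      refine hdart _ _ ?_ ?_ <;>
        simp only [hb1', hb2', hr1, hr2, hee, hdir, hlo, hhi, hedge, hdd, hd, hseg_eq.1, hseg_eq.2,
          Bool.not_false, cond_true]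
    · left
      refine hdart _ _ ?_ ?_ <;>
        simp only [hb1', hb2', hb1, hb2, hedge, hdd, hd, hseg_eq.1, hseg_eq.2]

end Summit.ValiantsHypothesis.ValiantsHypothesis.Theorems.CFIOddCover
end
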